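import Mathlib.Analysis.Complex.Liouville
import Mathlib.Analysis.Complex.CauchyIntegral
import Mathlib.Analysis.Complex.RealDeriv
import Mathlib.Analysis.Calculus.IteratedDeriv.Lemmas
import Mathlib.Analysis.Calculus.MeanValue
import Mathlib.Analysis.SpecialFunctions.Trigonometric.Deriv
import Mathlib.Analysis.SpecialFunctions.Trigonometric.DerivHyp
import Mathlib.Analysis.SpecialFunctions.Trigonometric.Bounds
import Literature.MathematicalPhysics.QuantumLattice.LatticeToriProofs

/-!
# One-variable Cauchy estimates for the free Wilson heat symbol
(helpers for stub `stub_freeKernelDecay` of line `point-centred-axial-parabolic`, crux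
`Summit.QuantumFields.QCD.Theses.HeatSlicedQuarks.SmallFieldUltracontractivity`, item stmt-QuantumFields-8871)

As a function of ONE lattice angle `θ` (the other three frozen) the symbol of the free massive
Wilson operator `D₁ᴴD₁` is affine in `1 − cos θ`, so the Fourier multiplier whose finite differences
control the spatial decay of the free heat kernel is the entire function
`G(ζ) = (1 − a e^{−iζ}) · exp(−β (1 − cos ζ))` (`β ≥ 0`; `a = 0` for kernel entries, `a = 1` for
nearest-neighbour differences).  This file proves the Cauchy estimate
`‖G⁽ⁿ⁾(t)‖ ≤ n! e² (1+β)^{n/2} (‖1 − a‖ + 6‖a‖ (1+β)^{-1/2}) e^{−(β/4)(1 − cos t)}` at real points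
(`norm_iteratedDeriv_symbolFactor_le`), from the lower bound
`Re (1 − cos ζ) ≥ ½ (1 − cos t) − 2r²` on the disc `‖ζ − t‖ ≤ r ≤ 1` and Mathlib's
`Complex.norm_iteratedDeriv_le_of_forall_mem_sphere_norm_le` with `r = (1+β)^{-1/2}`, and its
windowed form on `[θ, θ + δ]` (`norm_iteratedDeriv_symbolFactor_le_window`).

References: Cauchy's inequalities (folklore); pure theorem file (no definitions).
-/

noncomputable section

namespace Summit.QuantumFields.QCD.Cruxes.SmallFieldUltracontractivity.PointCentredAxialParabolic

open Complex Set Metric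

/-! ### Real trigonometric inequalities -/

/-- Polynomial core of `half_one_sub_cos_sub_le`: for points `(c,s)`, `(C,S)` on the unit circle,
`P > 0` and `5/4 − C ≤ P²`, one has `0 ≤ P + c (1/2 − C) + s S`. -/
theorem circle_aux {c s C S P : ℝ} (h1 : c ^ 2 + s ^ 2 = 1) (h2 : C ^ 2 + S ^ 2 = 1) (hP : 0 < P)
    (hPC : 5 / 4 - C ≤ P ^ 2) : 0 ≤ P + c * (1 / 2 - C) + s * S := by
  nlinarith [sq_nonneg (c * P + (1 / 2 - C)), sq_nonneg (s * P + S), mul_pos hP hP]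

/-- `½ (1 − cos t) − ξ²/2 ≤ 1 − cos (t + ξ)` for all real `t, ξ`. -/
theorem half_one_sub_cos_sub_le (t ξ : ℝ) :
    (1 - Real.cos t) / 2 - ξ ^ 2 / 2 ≤ 1 - Real.cos (t + ξ) := by
  rw [Real.cos_add]
  have h1 : Real.cos t ^ 2 + Real.sin t ^ 2 = 1 := Real.cos_sq_add_sin_sq t
  have h2 : Real.cos ξ ^ 2 + Real.sin ξ ^ 2 = 1 := Real.cos_sq_add_sin_sq ξ
  have h3 : 1 - ξ ^ 2 / 2 ≤ Real.cos ξ := Real.one_sub_sq_div_two_le_cos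
  have hP : (0 : ℝ) < 1 / 2 + ξ ^ 2 / 2 := by positivity
  have hPC : 5 / 4 - Real.cos ξ ≤ (1 / 2 + ξ ^ 2 / 2) ^ 2 := by nlinarith [sq_nonneg ξ]
  have := circle_aux h1 h2 hP hPC
  nlinarith

/-- Window form: for `θ ≤ t ≤ θ + δ`, `½ (1 − cos θ) − δ²/2 ≤ 1 − cos t`. -/
theorem half_one_sub_cos_sub_le_of_mem {θ t δ : ℝ} (h1 : θ ≤ t) (h2 : t ≤ θ + δ) :
    (1 - Real.cos θ) / 2 - δ ^ 2 / 2 ≤ 1 - Real.cos t := by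
  have h := half_one_sub_cos_sub_le θ (t - θ)
  rw [add_sub_cancel] at h
  have hsq : (t - θ) ^ 2 ≤ δ ^ 2 := by nlinarith
  linarith

/-! ### The disc estimate for `Re (1 − cos ζ)` -/

/-- The real part of the complex cosine: `Re cos ζ = cos (Re ζ) cosh (Im ζ)`. -/
theorem cos_re_eq (ζ : ℂ) : (Complex.cos ζ).re = Real.cos ζ.re * Real.cosh ζ.im := by
  rw [Complex.cos_eq]
  simp [Complex.sub_re, Complex.mul_re, Complex.cos_ofReal_re, Complex.cosh_ofReal_re,
    Complex.cos_ofReal_im, Complex.cosh_ofReal_im, Complex.sin_ofReal_im, Complex.sinh_ofReal_im]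

/-- On the disc `‖ζ − t‖ ≤ r ≤ 1` around a real point: `½ (1 − cos t) − 2r² ≤ Re (1 − cos ζ)`. -/
theorem re_one_sub_cos_ge {t r : ℝ} {ζ : ℂ} (hr : r ≤ 1) (hζ : ‖ζ - t‖ ≤ r) :
    (1 - Real.cos t) / 2 - 2 * r ^ 2 ≤ (1 - Complex.cos ζ).re := by
  have hξ : |ζ.re - t| ≤ r := by
    have h := abs_re_le_norm (ζ - t)
    simp only [Complex.sub_re, Complex.ofReal_re] at h
    exact h.trans hζ
  have hη : |ζ.im| ≤ r := by
    have h := abs_im_le_norm (ζ - t)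
    simp only [Complex.sub_im, Complex.ofReal_im, sub_zero] at h
    exact h.trans hζ
  have hη1 : |ζ.im| ≤ 1 := hη.trans hr
  have hcosh : Real.cosh ζ.im - 1 ≤ ζ.im ^ 2 :=
    Literature.MathematicalPhysics.QuantumLattice.cosh_sub_one_le_sq hη1
  have hcosh1 : 1 ≤ Real.cosh ζ.im := Real.one_le_cosh _
  have hcos1 : Real.cos ζ.re ≤ 1 := Real.cos_le_one _
  have hA : (1 - Real.cos t) / 2 - (ζ.re - t) ^ 2 / 2 ≤ 1 - Real.cos ζ.re := by
    have := half_one_sub_cos_sub_le t (ζ.re - t)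
    rwa [add_sub_cancel] at this
  have hξ2 : (ζ.re - t) ^ 2 ≤ r ^ 2 := by
    rw [← sq_abs]; exact pow_le_pow_left₀ (abs_nonneg _) hξ 2
  have hη2 : ζ.im ^ 2 ≤ r ^ 2 := by
    rw [← sq_abs]; exact pow_le_pow_left₀ (abs_nonneg _) hη 2
  rw [Complex.sub_re, Complex.one_re, cos_re_eq]
  nlinarith [mul_nonneg (sub_nonneg.2 hcos1) (sub_nonneg.2 hcosh1)]

/-- `‖exp (−β (1 − cos ζ))‖ ≤ e^{2βr²} e^{−(β/2)(1 − cos t)}` on the disc `‖ζ − t‖ ≤ r ≤ 1` (`β ≥ 0`). -/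
theorem norm_cexp_neg_mul_one_sub_cos_le {β t r : ℝ} (hβ : 0 ≤ β) {ζ : ℂ} (hr : r ≤ 1)
    (hζ : ‖ζ - t‖ ≤ r) :
    ‖Complex.exp (-(β : ℂ) * (1 - Complex.cos ζ))‖ ≤
      Real.exp (2 * β * r ^ 2) * Real.exp (-(β / 2 * (1 - Real.cos t))) := by
  rw [Complex.norm_exp, ← Real.exp_add]
  apply Real.exp_le_exp.2
  have h := re_one_sub_cos_ge hr hζ
  have hre : (-(β : ℂ) * (1 - Complex.cos ζ)).re = -β * (1 - Complex.cos ζ).re := by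
    simp [Complex.mul_re]
  rw [hre]
  nlinarith

/-! ### The prefactor `1 − a e^{−iζ}` -/

/-- At a real point: `‖1 − e^{−it}‖ = 2 √((1 − cos t)/2)`. -/
theorem norm_one_sub_cexp_neg_I_mul (t : ℝ) :
    ‖1 - Complex.exp (-(Complex.I * t))‖ = 2 * Real.sqrt ((1 - Real.cos t) / 2) := by
  have h := Complex.norm_exp_I_mul_ofReal_sub_one (-t)
  rw [← Real.abs_sin_half, ← norm_sub_rev]
  have e1 : Complex.I * ((-t : ℝ) : ℂ) = -(Complex.I * t) := by push_cast; ring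
  rw [e1] at h
  rw [h, Real.norm_eq_abs, abs_mul, abs_two, neg_div, Real.sin_neg, abs_neg]

/-- On the disc `‖ζ − t‖ ≤ r ≤ 1`: `‖1 − a e^{−iζ}‖ ≤ ‖1 − a‖ + ‖a‖ (2√((1 − cos t)/2) + 2r)`. -/
theorem norm_one_sub_mul_cexp_le (a : ℂ) {t r : ℝ} {ζ : ℂ} (hr : r ≤ 1) (hζ : ‖ζ - t‖ ≤ r) :
    ‖1 - a * Complex.exp (-(Complex.I * ζ))‖ ≤
      ‖1 - a‖ + ‖a‖ * (2 * Real.sqrt ((1 - Real.cos t) / 2) + 2 * r) := by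
  have hsplit : 1 - a * Complex.exp (-(Complex.I * ζ)) =
      (1 - a) + a * ((1 - Complex.exp (-(Complex.I * t))) +
        Complex.exp (-(Complex.I * t)) * (1 - Complex.exp (-(Complex.I * (ζ - t))))) := by
    have : Complex.exp (-(Complex.I * ζ)) =
        Complex.exp (-(Complex.I * t)) * Complex.exp (-(Complex.I * (ζ - t))) := by
      rw [← Complex.exp_add]; ring_nf
    rw [this]; ring
  have hsmall : ‖1 - Complex.exp (-(Complex.I * (ζ - t)))‖ ≤ 2 * r := by
    rw [norm_sub_rev]
    have hz : ‖-(Complex.I * (ζ - t))‖ ≤ 1 := by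
      rw [norm_neg, norm_mul, Complex.norm_I, one_mul]; exact hζ.trans hr
    calc ‖Complex.exp (-(Complex.I * (ζ - t))) - 1‖ ≤ 2 * ‖-(Complex.I * (ζ - t))‖ :=
          Complex.norm_exp_sub_one_le hz
      _ ≤ 2 * r := by
          rw [norm_neg, norm_mul, Complex.norm_I, one_mul]; linarith
  have hunit : ‖Complex.exp (-(Complex.I * t))‖ = 1 := by
    have : -(Complex.I * (t : ℂ)) = ((-t : ℝ) : ℂ) * Complex.I := by push_cast; ring
    rw [this, Complex.norm_exp_ofReal_mul_I]
  rw [hsplit]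
  calc ‖(1 - a) + a * ((1 - Complex.exp (-(Complex.I * t))) +
        Complex.exp (-(Complex.I * t)) * (1 - Complex.exp (-(Complex.I * (ζ - t)))))‖
      ≤ ‖1 - a‖ + ‖a‖ * (‖1 - Complex.exp (-(Complex.I * t))‖ +
          ‖Complex.exp (-(Complex.I * t))‖ * ‖1 - Complex.exp (-(Complex.I * (ζ - t)))‖) := by
        refine (norm_add_le _ _).trans ?_
        rw [norm_mul]
        gcongr
        exact (norm_add_le _ _).trans (by rw [norm_mul])
    _ ≤ ‖1 - a‖ + ‖a‖ * (2 * Real.sqrt ((1 - Real.cos t) / 2) + 2 * r) := by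
        rw [norm_one_sub_cexp_neg_I_mul, hunit, one_mul]
        gcongr

/-- The square-root gain: for `0 ≤ w ≤ 2`, `β ≥ 0`: `2 √(w/2) · √(1+β) ≤ 4 e^{β w/8}`. -/
theorem two_sqrt_mul_sqrt_le {w β : ℝ} (hw0 : 0 ≤ w) (hw2 : w ≤ 2) (hβ : 0 ≤ β) :
    2 * Real.sqrt (w / 2) * Real.sqrt (1 + β) ≤ 4 * Real.exp (β * w / 8) := by
  rw [mul_assoc, ← Real.sqrt_mul (by positivity)]
  have hx := Real.add_one_le_exp (β * w / 8)
  have hpos := Real.exp_pos (β * w / 8)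
  have h : Real.sqrt (w / 2 * (1 + β)) ≤ 2 * Real.exp (β * w / 8) := by
    rw [Real.sqrt_le_left (by positivity)]
    nlinarith [mul_nonneg hβ hw0]
  linarith

/-! ### Cauchy estimates for the one-variable symbol factor -/

/-- Cauchy's inequality at a real point from a sup bound on the closed disc of radius `r`. -/
theorem norm_iteratedDeriv_le_of_closedBall {e : ℂ → ℂ} (he : Differentiable ℂ e) {t r N : ℝ}
    (hr : 0 < r) (hN : ∀ ζ : ℂ, ‖ζ - t‖ ≤ r → ‖e ζ‖ ≤ N) (n : ℕ) :
    ‖iteratedDeriv n e t‖ ≤ n.factorial * N / r ^ n :=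
  Complex.norm_iteratedDeriv_le_of_forall_mem_sphere_norm_le n hr he.diffContOnCl
    (fun ζ hζ => hN ζ (by rw [mem_sphere_iff_norm] at hζ; exact hζ.le))

/-- The symbol factor `ζ ↦ (1 − a e^{−iζ}) exp (−β (1 − cos ζ))` is entire. -/
theorem differentiable_symbolFactor (a : ℂ) (β : ℝ) :
    Differentiable ℂ (fun ζ : ℂ => (1 - a * Complex.exp (-(Complex.I * ζ))) *
      Complex.exp (-(β : ℂ) * (1 - Complex.cos ζ))) := by
  fun_prop

/-- Sup bound for the symbol factor on the disc `‖ζ − t‖ ≤ r`, `r = (1+β)^{-1/2}`: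
`‖G(ζ)‖ ≤ e² (‖1 − a‖ + 6‖a‖ r) e^{−(β/4)(1 − cos t)}`. -/
theorem norm_symbolFactor_le_of_mem_disc {β : ℝ} (hβ : 0 ≤ β) (a : ℂ) (t : ℝ) {ζ : ℂ}
    (hζ : ‖ζ - t‖ ≤ (Real.sqrt (1 + β))⁻¹) :
    ‖(1 - a * Complex.exp (-(Complex.I * ζ))) * Complex.exp (-(β : ℂ) * (1 - Complex.cos ζ))‖ ≤
      Real.exp 2 * (‖1 - a‖ + 6 * ‖a‖ * (Real.sqrt (1 + β))⁻¹) *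
        Real.exp (-(β / 4 * (1 - Real.cos t))) := by
  set r : ℝ := (Real.sqrt (1 + β))⁻¹ with hr
  have hs1 : 1 ≤ Real.sqrt (1 + β) := by
    rw [Real.le_sqrt (by norm_num) (by positivity)]; linarith
  have hspos : 0 < Real.sqrt (1 + β) := by positivity
  have hr0 : 0 < r := by positivity
  have hr1 : r ≤ 1 := inv_le_one_of_one_le₀ hs1
  have hr2 : β * r ^ 2 ≤ 1 := by
    rw [hr, inv_pow, Real.sq_sqrt (by positivity)]
    rw [mul_inv_le_iff₀ (by positivity)]; linarith
  set w : ℝ := 1 - Real.cos t with hw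
  have hw0 : 0 ≤ w := sub_nonneg.2 (Real.cos_le_one t)
  have hw2 : w ≤ 2 := by have := Real.neg_one_le_cos t; rw [hw]; linarith
  have hE := norm_cexp_neg_mul_one_sub_cos_le hβ hr1 hζ
  have hP := norm_one_sub_mul_cexp_le a hr1 hζ
  rw [norm_mul]
  -- the Gaussian factor
  have hE' : ‖Complex.exp (-(β : ℂ) * (1 - Complex.cos ζ))‖ ≤
      Real.exp 2 * Real.exp (-(β / 2 * w)) := by
    refine hE.trans ?_
    gcongr
    nlinarith
  -- the square-root gain on the prefactor
  have hgain : 2 * Real.sqrt (w / 2) * Real.exp (-(β / 2 * w)) ≤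
      4 * r * Real.exp (-(β / 4 * w)) := by
    have h := two_sqrt_mul_sqrt_le hw0 hw2 hβ
    have e1 : Real.exp (-(β / 2 * w)) = Real.exp (β * w / 8) * Real.exp (-(β / 4 * w)) *
        Real.exp (-(3 * β * w / 8)) := by
      rw [← Real.exp_add, ← Real.exp_add]; ring_nf
    have e2 : Real.exp (-(3 * β * w / 8)) ≤ 1 := by
      rw [Real.exp_le_one_iff]; nlinarith [mul_nonneg hβ hw0]
    have h2 : 2 * Real.sqrt (w / 2) ≤ 4 * Real.exp (β * w / 8) * r := by
      rw [hr, ← div_eq_mul_inv, le_div_iff₀ hspos]; exact h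
    calc 2 * Real.sqrt (w / 2) * Real.exp (-(β / 2 * w))
        ≤ (4 * Real.exp (β * w / 8) * r) * Real.exp (-(β / 2 * w)) := by gcongr
      _ = 4 * r * Real.exp (-(β / 4 * w)) *
          (Real.exp (β * w / 8) * Real.exp (β * w / 8) * Real.exp (-(3 * β * w / 8))) := by
          rw [e1]; ring
      _ = 4 * r * Real.exp (-(β / 4 * w)) * Real.exp (-(β * w / 8)) := by
          congr 1; rw [← Real.exp_add, ← Real.exp_add]; ring_nf
      _ ≤ 4 * r * Real.exp (-(β / 4 * w)) * 1 := by
          gcongr; rw [Real.exp_le_one_iff]; nlinarith [mul_nonneg hβ hw0]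
      _ = 4 * r * Real.exp (-(β / 4 * w)) := mul_one _
  have hhalf : Real.exp (-(β / 2 * w)) ≤ Real.exp (-(β / 4 * w)) := by
    apply Real.exp_le_exp.2; nlinarith [mul_nonneg hβ hw0]
  calc ‖1 - a * Complex.exp (-(Complex.I * ζ))‖ * ‖Complex.exp (-(β : ℂ) * (1 - Complex.cos ζ))‖
      ≤ (‖1 - a‖ + ‖a‖ * (2 * Real.sqrt (w / 2) + 2 * r)) * (Real.exp 2 * Real.exp (-(β / 2 * w))) :=
        mul_le_mul hP hE' (norm_nonneg _) (by positivity)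
    _ = Real.exp 2 * (‖1 - a‖ * Real.exp (-(β / 2 * w)) +
          ‖a‖ * (2 * Real.sqrt (w / 2) * Real.exp (-(β / 2 * w))) +
          ‖a‖ * (2 * r) * Real.exp (-(β / 2 * w))) := by ring
    _ ≤ Real.exp 2 * (‖1 - a‖ * Real.exp (-(β / 4 * w)) +
          ‖a‖ * (4 * r * Real.exp (-(β / 4 * w))) +
          ‖a‖ * (2 * r) * Real.exp (-(β / 4 * w))) := by gcongr
    _ = Real.exp 2 * (‖1 - a‖ + 6 * ‖a‖ * r) * Real.exp (-(β / 4 * w)) := by ring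

/-- **Cauchy estimate for the symbol factor** at real points: for `β ≥ 0`, every `a : ℂ` and `n`,
`‖G⁽ⁿ⁾(t)‖ ≤ n! e² (√(1+β))ⁿ (‖1 − a‖ + 6‖a‖ (√(1+β))⁻¹) e^{−(β/4)(1 − cos t)}`. -/
theorem norm_iteratedDeriv_symbolFactor_le {β : ℝ} (hβ : 0 ≤ β) (a : ℂ) (n : ℕ) (t : ℝ) :
    ‖iteratedDeriv n (fun ζ : ℂ => (1 - a * Complex.exp (-(Complex.I * ζ))) *
        Complex.exp (-(β : ℂ) * (1 - Complex.cos ζ))) t‖ ≤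
      n.factorial * (Real.exp 2 * (‖1 - a‖ + 6 * ‖a‖ * (Real.sqrt (1 + β))⁻¹) *
        Real.exp (-(β / 4 * (1 - Real.cos t)))) * Real.sqrt (1 + β) ^ n := by
  have hspos : 0 < Real.sqrt (1 + β) := Real.sqrt_pos.2 (by positivity)
  have hr0 : 0 < (Real.sqrt (1 + β))⁻¹ := by positivity
  have h := norm_iteratedDeriv_le_of_closedBall (differentiable_symbolFactor a β) hr0
    (fun ζ hζ => norm_symbolFactor_le_of_mem_disc hβ a t hζ) n
  rw [inv_pow, div_inv_eq_mul] at h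
  exact h

/-- **Windowed Cauchy estimate**: for `β ≥ 0`, `θ ≤ t ≤ θ + δ`,
`‖G⁽ⁿ⁾(t)‖ ≤ n! e² (√(1+β))ⁿ (‖1 − a‖ + 6‖a‖ (√(1+β))⁻¹) e^{βδ²/8} e^{−(β/8)(1 − cos θ)}`. -/
theorem norm_iteratedDeriv_symbolFactor_le_window {β : ℝ} (hβ : 0 ≤ β) (a : ℂ) (n : ℕ)
    {θ t δ : ℝ} (h1 : θ ≤ t) (h2 : t ≤ θ + δ) :
    ‖iteratedDeriv n (fun ζ : ℂ => (1 - a * Complex.exp (-(Complex.I * ζ))) *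
        Complex.exp (-(β : ℂ) * (1 - Complex.cos ζ))) t‖ ≤
      n.factorial * Real.exp 2 * Real.sqrt (1 + β) ^ n *
        (‖1 - a‖ + 6 * ‖a‖ * (Real.sqrt (1 + β))⁻¹) *
        Real.exp (β * δ ^ 2 / 8) * Real.exp (-(β / 8 * (1 - Real.cos θ))) := by
  have h := norm_iteratedDeriv_symbolFactor_le hβ a n t
  have hwin := half_one_sub_cos_sub_le_of_mem h1 h2
  have hexp : Real.exp (-(β / 4 * (1 - Real.cos t))) ≤
      Real.exp (β * δ ^ 2 / 8) * Real.exp (-(β / 8 * (1 - Real.cos θ))) := by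
    rw [← Real.exp_add]
    apply Real.exp_le_exp.2
    nlinarith
  calc _ ≤ _ := h
    _ ≤ n.factorial * (Real.exp 2 * (‖1 - a‖ + 6 * ‖a‖ * (Real.sqrt (1 + β))⁻¹) *
        (Real.exp (β * δ ^ 2 / 8) * Real.exp (-(β / 8 * (1 - Real.cos θ))))) *
        Real.sqrt (1 + β) ^ n := by gcongr
    _ = _ := by ring

/-- **Registered sub-goal `stub_fkdSymbolWindow`** (explicit-binder export of
`norm_iteratedDeriv_symbolFactor_le_window`): the windowed Cauchy estimate for the one-variable
symbol factor `G(ζ) = (1 − a e^{−iζ}) exp (−β (1 − cos ζ))` of the free Wilson heat kernel. -/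
theorem stub_fkdSymbolWindow : ∀ (β : ℝ), 0 ≤ β → ∀ (a : ℂ) (n : ℕ) (θ t δ : ℝ), θ ≤ t → t ≤ θ + δ → ‖iteratedDeriv n (fun ζ : ℂ => (1 - a * Complex.exp (-(Complex.I * ζ))) * Complex.exp (-(β : ℂ) * (1 - Complex.cos ζ))) (t : ℂ)‖ ≤ (n.factorial : ℝ) * Real.exp 2 * Real.sqrt (1 + β) ^ n * (‖1 - a‖ + 6 * ‖a‖ * (Real.sqrt (1 + β))⁻¹) * Real.exp (β * δ ^ 2 / 8) * Real.exp (-(β / 8 * (1 - Real.cos θ))) :=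
  fun _ hβ a n _ _ _ h1 h2 => norm_iteratedDeriv_symbolFactor_le_window hβ a n h1 h2

end Summit.QuantumFields.QCD.Cruxes.SmallFieldUltracontractivity.PointCentredAxialParabolic

end
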